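import Literature.NumberTheory.LFunctions.FordLargeLambdaCore
import HarnessLib

/-!
# Ford (2002), §5: the interval theorem with Theorem 4' in place of Theorem 4

Topic `Literature/NumberTheory/LFunctions`. Pure proof file (one theorem, no `def`).

`FordVK.sec5_interval` (`FordLargeLambdaCore.lean`) deduces Theorem 2 of [Ford2002] on a certified
`λ`-interval from a row `(ρ, θ)` of (1.7) (Theorem 3) and from Theorem 4 **verbatim** (constant
`log (1/(10η))` in the exponent of `e`).  The tree proves Theorem 4 in the slightly weaker library
form `FordVK.ford_theorem4_lib` (`FordIncompleteTheorem4.lean`: `log (1/(12η))` for `log (1/(10η))`,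
one extra hypothesis `80 ≤ η log P`, which holds at every application in §5 by (5.19)), and the rows
of (1.7) for `k ≤ 1190` with `θ' = θ + O(10⁻³)` (`FordTheorem3Rows.lean`).  This file re-proves the
interval theorem from these inputs WITHOUT touching the certificates:

* `FordVK.sec5_interval2` — same certificate conditions `c0`–`c9` as `FordVK.sec5_interval` (so the
  kernel-checked rows of `FordLargeLambdaRows*.lean` and `FordVK.Sec5Row.sound` apply unchanged), the
  row of (1.7) at any `θ₁ ≤ θ + 0.0008`, Theorem 4' as hypothesis `hT4'`, and the two cheap side
  conditions `3.2 ≤ ρ`, `k² ≤ 120 s`; conclusion with constant `1.06 · Ctar` in place of `Ctar`.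
  The defect `(θ₁ − θ) k³ log k/(2rs) + (CT4' − CT4)/(2rs) ≤ 0.0008 k⁴/(2rs) + 0.2/(2rη) ≤ 0.05`
  (using `r ≥ 3.2k²`, `s ≥ k²/120`, `1/η ≤ 0.765 g²` from (1.10)) costs a factor `e^{0.05} ≤ 1.053`.

The proof is that of `FordVK.sec5_interval` [Ford2002, §5, (5.17)–(5.22), Lemmas 5.2–5.3] with the
defect estimate inserted before the constant condition `c8` is used.

## References
* K. Ford, *Vinogradov's integral and bounds for the Riemann zeta function*, Proc. London Math.
  Soc. (3) 85 (2002), 565–633; arXiv:1910.08209: §5, Theorem 2, Lemmas 5.2–5.3. [Ford2002]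
-/

noncomputable section

open Finset Real

namespace Literature.NumberTheory.LFunctions
namespace FordVK

open VMV

set_option maxHeartbeats 400000 in
/-- **Ford's §5 interval theorem from Theorem 4' and a perturbed row of (1.7).** Same certificate
conditions `c0`–`c9` as `FordVK.sec5_interval`; the row of (1.7) at any `θ₁ ≤ θ + 0.0008`;
Theorem 4' (`hT4'`, the shape of `FordVK.ford_theorem4_lib`); `3.2 ≤ ρ`, `k² ≤ 120 s`; conclusion
`‖S‖ ≤ 1.06 Ctar · N^{1 − (log N)²/(133.66 (log t)²)}` in the nontrivial range `log N ≥ 300λ²`.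
[cite: Ford2002, §5, proofs of Lemmas 5.2–5.3, (5.17)–(5.22)] -/
theorem sec5_interval2
    {k h g s m₁ m₂ wp : ℕ} {lamlo lamhi η ρ θ θ₁ Ctar : ℝ}
    -- the row of (1.7) for this `k` (Theorem 3)
    (hT3 : ∃ s₃ : ℕ, 1 ≤ s₃ ∧ (s₃ : ℝ) ≤ ρ * (k : ℝ) ^ 2 ∧ ∀ P : ℕ, 1 ≤ P →
      (J k s₃ (Finset.Icc (1 : ℤ) P) : ℝ) ≤ (k : ℝ) ^ (θ₁ * (k : ℝ) ^ 3)
        * (P : ℝ) ^ ((2 * s₃ : ℝ) - ((k * (k + 1) / 2 : ℕ) : ℝ) + 0.001 * (k : ℝ) ^ 2))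
    -- Theorem 4' (`FordVK.ford_theorem4_lib`: constant `12` for `10`, extra hypothesis `80 ≤ η log P`)
    (hT4' : ∀ (k h s : ℕ) (P η D : ℝ), 60 ≤ k → (0.9 : ℝ) * k ≤ h → h + 2 ≤ k →
      2 * (k - h + 1) ≤ s → s ≤ (h / 2) * (k - h + 1) → 10 ≤ D → Real.exp (D * (k : ℝ) ^ 2) ≤ P →
      2 / (k : ℝ) ^ 3 < η → η ≤ 1 / (2 * (k : ℝ)) →
      18 / (k : ℝ) ≤ 4 * Real.log k / (D * (k : ℝ) ^ 2 * η) →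
      4 * Real.log k / (D * (k : ℝ) ^ 2 * η) ≤ 0.4 → 80 ≤ η * Real.log P →
      (Jinc k s ((calC P (P ^ η)).map Nat.castEmbedding) h k : ℝ)
        ≤ Real.exp ((s : ℝ) ^ 2 / ((k : ℝ) - h + 1)
            + 10.5 * ((k : ℝ) - h + 1) * Real.log k ^ 2 / (D * k * η ^ 2)
            - s * ((1 / η + h) * (1 - 1 / (h : ℝ)) ^ ((s : ℝ) / ((k : ℝ) - h + 1)) - h)
              * Real.log (1 / (12 * η)))
          * P ^ ((2 * s : ℝ) - ((k : ℝ) - h + 1) / 2 * (h + k) + ((k : ℝ) - h + 1) * ((k : ℝ) - h) / 2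
            + η * (s : ℝ) ^ 2 / (2 * ((k : ℝ) - h + 1))
            + h * ((k : ℝ) - h + 1) * Real.exp (-(s : ℝ) / (h * ((k : ℝ) - h + 1)))))
    -- the certificate conditions (rational data; verified by the interval checker)
    (c0 : 87 ≤ lamlo) (c0' : lamlo ≤ lamhi) (hη : 0 < η) (hCtar : 0.002 < Ctar)
    (hθ1 : θ₁ ≤ θ + 0.0008) (hρ : 3.2 ≤ ρ) (hks : k ^ 2 ≤ 120 * s)
    (c1 : lamhi - 0.6492 * k + 0.3508 ≤ 1 - 1.9e-6)
    (c2a : 60 ≤ g) (c2b : (0.9 : ℝ) * g ≤ h) (c2c : h + 2 ≤ g) (c2d : 2 * (g - h + 1) ≤ s)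
    (c2e : s ≤ (h / 2) * (g - h + 1))
    (c3 : 30.57 * (g : ℝ) ^ 2 ≤ 0.1603 * 300 * lamlo ^ 2)
    (c4a : 2 / (g : ℝ) ^ 3 < η) (c4b : η ≤ 1 / (2 * (g : ℝ)))
    (c4c : 18 / (g : ℝ) ≤ 4 * Real.log g / (30.57 * (g : ℝ) ^ 2 * η))
    (c4d : 4 * Real.log g / (30.57 * (g : ℝ) ^ 2 * η) ≤ 0.4)
    (c5a : 80 ≤ η * (0.1603 * 300 * lamlo ^ 2)) (c5b : 2 ≤ 1 / η) (c5c : 26 * (1 / η) / 25 ≤ wp)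
    (c6a : h ≤ m₂ + 1) (c6b : m₂ ≤ m₁) (c6c : m₁ ≤ g)
    (c6d : (m₂ : ℝ) * (1 - 0.1603) ≤ lamlo) (c6e : lamhi ≤ ((m₂ : ℝ) + 1) * (1 - 0.1603))
    (c6f : (m₁ : ℝ) * (1 - 0.1905) ≤ lamlo) (c6g : lamhi ≤ ((m₁ : ℝ) + 1) * (1 - 0.1905))
    (c7a : s ≤ ⌊ρ * (k : ℝ) ^ 2⌋₊ + 1) (c7b : 1 ≤ h) (c7c : g ≤ k)
    (c8 : (1 / ((⌊ρ * (k : ℝ) ^ 2⌋₊ : ℕ) + 1 : ℝ))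
        * (wp * Real.log (208 / 7) + ((wp : ℝ) + 2) * Real.log ((wp : ℝ) + 2) - ((wp : ℝ) + 1)
          + Real.log (η * 0.1603))
        + (1 / (2 * (((⌊ρ * (k : ℝ) ^ 2⌋₊ : ℕ) : ℝ) + 1) * s))
          * (θ * (k : ℝ) ^ 3 * Real.log k
            + ((s : ℝ) ^ 2 / ((g : ℝ) - h + 1)
              + 10.5 * ((g : ℝ) - h + 1) * Real.log g ^ 2 / (30.57 * g * η ^ 2)
              - s * ((1 / η + h) * (1 - 1 / (h : ℝ)) ^ ((s : ℝ) / ((g : ℝ) - h + 1)) - h)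
                * Real.log (1 / (10 * η)))
            + k * Real.log (5 * ((((⌊ρ * (k : ℝ) ^ 2⌋₊ : ℕ) : ℝ) + 1)))
            + ((g : ℝ) - h + 1) * Real.log (16 * (g : ℝ) * 4 ^ g * s))
        ≤ Real.log (Ctar - 0.002))
    (c9 : ∀ lstar : ℝ, lstar = lamlo ∨ lstar = lamhi →
      Real.log (300 * lamlo ^ 2) / (300 * lamlo ^ 2) / ((((⌊ρ * (k : ℝ) ^ 2⌋₊ : ℕ) : ℝ) + 1))
        + (0.1905 * (0.001 * (k : ℝ) ^ 2)
            + 0.1603 * (((g : ℝ) - h + 1) * ((g : ℝ) - h) / 2 + η * (s : ℝ) ^ 2 / (2 * ((g : ℝ) - h + 1))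
              + h * ((g : ℝ) - h + 1) * Real.exp (-(s : ℝ) / (h * ((g : ℝ) - h + 1))))
            - ((((m₂ : ℝ) - h + 1) * (h + m₂) / 2
                + 0.1603 * (((m₁ : ℝ) - m₂) * ((m₂ : ℝ) + 1 + m₁) / 2)
                - (1 - 0.1905 - 0.1603) * (((g : ℝ) - m₁) * ((m₁ : ℝ) + 1 + g) / 2))
              + (((g : ℝ) - m₁) - ((m₂ : ℝ) + 1 - h)) * lstar))
          / (2 * ((((⌊ρ * (k : ℝ) ^ 2⌋₊ : ℕ) : ℝ) + 1)) * s)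
        + 1 / (133.66 * lamlo ^ 2) ≤ 0)
    -- the sum
    {N R₀ : ℕ} {t u : ℝ} (hN : 2 ≤ N) (hNR : N < R₀) (hR : R₀ ≤ 2 * N) (hu0 : 0 < u) (hu1 : u ≤ 1)
    (ht0 : 0 < t) (hlo : lamlo * Real.log N ≤ Real.log t) (hhi : Real.log t ≤ lamhi * Real.log N)
    (hbig : 300 * (Real.log t / Real.log N) ^ 2 ≤ Real.log N) :
    ‖∑ n ∈ Ioc N R₀, ((n : ℂ) + u) ^ (-(t * Complex.I))‖
      ≤ 1.06 * Ctar * (N : ℝ) ^ (1 - Real.log N ^ 2 / (133.66 * Real.log t ^ 2)) := by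
  -- ### basic quantities
  have hN0 : (0 : ℝ) < N := by positivity
  have hN1 : (1 : ℝ) < N := by exact_mod_cast (by omega : 1 < N)
  set L : ℝ := Real.log N with hL
  have hLpos : 0 < L := Real.log_pos hN1
  obtain ⟨lam, hlam⟩ : ∃ x : ℝ, x = Real.log t / L := ⟨_, rfl⟩
  have hlamlo : lamlo ≤ lam := by rw [hlam, le_div_iff₀ hLpos]; exact hlo
  have hlamhi : lam ≤ lamhi := by rw [hlam, div_le_iff₀ hLpos]; exact hhi
  have hlam87 : 87 ≤ lam := c0.trans hlamlo
  have hlam0 : 0 < lam := by linarith only [hlam87]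
  have hlogt : Real.log t = lam * L := by rw [hlam]; field_simp
  have ht : t = (N : ℝ) ^ lam := by
    rw [Real.rpow_def_of_pos hN0, ← hL, mul_comm, ← hlogt, Real.exp_log ht0]
  have hLlam : 300 * lam ^ 2 ≤ L := by rw [hlam]; exact hbig
  have hLlo : 300 * lamlo ^ 2 ≤ L := le_trans (by nlinarith only [hlamlo, c0]) hLlam
  have hLge : (2270700 : ℝ) ≤ L := le_trans (by nlinarith only [c0]) hLlo
  -- `r`
  set r : ℕ := ⌊ρ * (k : ℝ) ^ 2⌋₊ + 1 with hr
  have hr1 : 1 ≤ r := by omega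
  have hrreal : (r : ℝ) = ((⌊ρ * (k : ℝ) ^ 2⌋₊ : ℕ) : ℝ) + 1 := by rw [hr]; push_cast; ring
  have hr0 : (0 : ℝ) < r := by positivity
  -- `k ≥ 133`
  have hk133 : (133 : ℝ) ≤ k := by linarith only [c1, c0, c0']
  have hk1 : 1 ≤ k := by
    have : (1 : ℝ) ≤ k := by linarith only [hk133]
    exact_mod_cast this
  have hkpos : (0 : ℝ) < k := by linarith only [hk133]
  -- ### `M₁`, `M₂`, `M`
  set M₁ : ℝ := (N : ℝ) ^ (0.1905 : ℝ) with hM₁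
  set M₂ : ℝ := (N : ℝ) ^ (0.1603 : ℝ) with hM₂
  set M : ℕ := ⌊M₁⌋₊ with hM
  have hlogM₂ : Real.log M₂ = 0.1603 * L := by rw [hM₂, Real.log_rpow hN0]
  have hlogM₁ : Real.log M₁ = 0.1905 * L := by rw [hM₁, Real.log_rpow hN0]
  have hM₂1 : 1 < M₂ := Real.one_lt_rpow hN1 (by norm_num)
  have hM₂0 : 0 < M₂ := by linarith only [hM₂1]
  have hM₁1 : 1 ≤ M₁ := Real.one_le_rpow hN1.le (by norm_num)
  have hM1 : 1 ≤ M := Nat.le_floor (by simpa using hM₁1)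
  have hM₂M : M₂ ≤ M := by
    -- `M₁ = M₂ N^{0.0302} ≥ 2 M₂`, `M ≥ M₁ - 1`
    have h1 : M₁ = M₂ * (N : ℝ) ^ (0.0302 : ℝ) := by
      rw [hM₁, hM₂, ← Real.rpow_add hN0]; norm_num
    have h2 : (2 : ℝ) ≤ (N : ℝ) ^ (0.0302 : ℝ) := by
      have : Real.log 2 ≤ 0.0302 * L := by
        have := Real.log_two_lt_d9; linarith only [this, hLge]
      calc (2 : ℝ) = Real.exp (Real.log 2) := (Real.exp_log two_pos).symm
        _ ≤ Real.exp (0.0302 * L) := Real.exp_le_exp.2 this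
        _ = (N : ℝ) ^ (0.0302 : ℝ) := by rw [Real.rpow_def_of_pos hN0, hL]; ring_nf
    have h3 : (M : ℝ) ≥ M₁ - 1 := by
      have := Nat.lt_floor_add_one M₁; rw [← hM] at this; linarith only [this]
    have h4 : 2 * M₂ ≤ M₁ := by rw [h1]; nlinarith only [h2, hM₂0]
    linarith only [h3, h4, hM₂1]
  -- ### (5.19): `M₂ ≤ C₃ |ℬ|`
  set B : Finset ℕ := calC M₂ (M₂ ^ η) with hB
  have hlogR : 80 ≤ η * Real.log M₂ := by
    rw [hlogM₂]
    calc (80 : ℝ) ≤ η * (0.1603 * 300 * lamlo ^ 2) := c5a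
      _ ≤ η * (0.1603 * L) := by nlinarith only [hLlo, hη]
  have hBbound := M₂_le_C₃_card hM₂1 hη hlogR c5b c5c
  rw [← hB] at hBbound
  obtain ⟨C₃, hC₃def⟩ : ∃ x : ℝ, x = (208 / 7 : ℝ) ^ wp * ((wp + 1).factorial : ℝ) * (η * Real.log M₂) :=
    ⟨_, rfl⟩
  rw [← hC₃def] at hBbound
  have hC₃pos : 0 < C₃ := by
    rw [hC₃def]
    have : (0 : ℝ) < (wp + 1).factorial := by exact_mod_cast Nat.factorial_pos _
    have : 0 < η * Real.log M₂ := by linarith only [hlogR]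
    positivity
  -- ### (5.14): the row of (1.7)
  obtain ⟨s₃, hs₃1, hs₃ρ, hT3P⟩ := hT3
  have hs₃r : s₃ ≤ r := by
    have : s₃ ≤ ⌊ρ * (k : ℝ) ^ 2⌋₊ := Nat.le_floor hs₃ρ
    omega
  have hJ := J_row_bound (M := M) (θ := θ₁) hM1 hs₃r hk1 hT3P
  -- ### (5.17): Theorem 4 at `(g, h, s, M₂, η, D = 30.57)`
  have hexpM₂ : Real.exp (30.57 * (g : ℝ) ^ 2) ≤ M₂ := by
    have : 30.57 * (g : ℝ) ^ 2 ≤ Real.log M₂ := by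
      rw [hlogM₂]
      calc 30.57 * (g : ℝ) ^ 2 ≤ 0.1603 * 300 * lamlo ^ 2 := c3
        _ ≤ 0.1603 * L := by nlinarith only [hLlo]
    calc Real.exp (30.57 * (g : ℝ) ^ 2) ≤ Real.exp (Real.log M₂) := Real.exp_le_exp.2 this
      _ = M₂ := Real.exp_log hM₂0
  have h4 := hT4' g h s M₂ η 30.57 c2a c2b c2c c2d c2e (by norm_num) hexpM₂ c4a c4b c4c c4d hlogR
  rw [← hB, Jinc_eq_of_le (B.map Nat.castEmbedding) (le_refl g) c7c] at h4
  obtain ⟨E₂, hE₂⟩ : ∃ x : ℝ, x = ((g : ℝ) - h + 1) * ((g : ℝ) - h) / 2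
      + η * (s : ℝ) ^ 2 / (2 * ((g : ℝ) - h + 1))
      + h * ((g : ℝ) - h + 1) * Real.exp (-(s : ℝ) / (h * ((g : ℝ) - h + 1))) := ⟨_, rfl⟩
  obtain ⟨CT4, hCT4⟩ : ∃ x : ℝ, x = (s : ℝ) ^ 2 / ((g : ℝ) - h + 1)
      + 10.5 * ((g : ℝ) - h + 1) * Real.log g ^ 2 / (30.57 * g * η ^ 2)
      - s * ((1 / η + h) * (1 - 1 / (h : ℝ)) ^ ((s : ℝ) / ((g : ℝ) - h + 1)) - h)
        * Real.log (1 / (10 * η)) := ⟨_, rfl⟩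
  obtain ⟨CT4n, hCT4n⟩ : ∃ x : ℝ, x = (s : ℝ) ^ 2 / ((g : ℝ) - h + 1)
      + 10.5 * ((g : ℝ) - h + 1) * Real.log g ^ 2 / (30.57 * g * η ^ 2)
      - s * ((1 / η + h) * (1 - 1 / (h : ℝ)) ^ ((s : ℝ) / ((g : ℝ) - h + 1)) - h)
        * Real.log (1 / (12 * η)) := ⟨_, rfl⟩
  have hJinc : (Jinc k s (B.map Nat.castEmbedding) h g : ℝ)
      ≤ Real.exp CT4n * M₂ ^ ((2 * s : ℝ) - ((g : ℝ) - h + 1) * ((h : ℝ) + g) / 2 + E₂) := by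
    have e : (2 * s : ℝ) - ((g : ℝ) - h + 1) / 2 * (h + g) + ((g : ℝ) - h + 1) * ((g : ℝ) - h) / 2
        + η * (s : ℝ) ^ 2 / (2 * ((g : ℝ) - h + 1))
        + h * ((g : ℝ) - h + 1) * Real.exp (-(s : ℝ) / (h * ((g : ℝ) - h + 1)))
        = (2 * s : ℝ) - ((g : ℝ) - h + 1) * ((h : ℝ) + g) / 2 + E₂ := by rw [hE₂]; ring
    rw [hCT4n, ← e]; exact h4
  -- ### (5.11): the minorants
  have hμ : (0.1905 : ℝ) + 0.1603 ≤ 1 := by norm_num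
  have hℓ : ∀ j, h ≤ j → j ≤ g →
      ellMin 0.1905 0.1603 lam m₁ m₂ j ≤ j * 0.1603 ∧ ellMin 0.1905 0.1603 lam m₁ m₂ j ≤ j - lam
        ∧ ellMin 0.1905 0.1603 lam m₁ m₂ j ≤ lam - j * (1 - 0.1905 - 0.1603) := by
    intro j _ _
    exact ellMin_le (by norm_num) hμ (by norm_num) (by linarith only [c6d, hlamlo])
      (by linarith only [c6e, hlamhi]) (by linarith only [c6f, hlamlo]) (by linarith only [c6g, hlamhi])
  -- ### the core deduction
  have hs1 : 1 ≤ s := by omega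
  have hhg : h ≤ g := by omega
  have hcore := sec5_core (ellMin 0.1905 0.1603 lam m₁ m₂) B hN hNR hR hu0 hu1 ht
    (by norm_num : (0 : ℝ) < 0.1905) (by norm_num : (0 : ℝ) < 0.1603) hμ hr1 hs1 c7a c7b hhg c7c
    hM₂M (calC_nonempty hM₂1.le _) (calC_bounds hM₂0.le) (Real.rpow_pos_of_pos hkpos _)
    (Real.exp_pos CT4n) hC₃pos (by positivity : (0 : ℝ) ≤ 0.001 * (k : ℝ) ^ 2) hBbound hJ hJinc hℓ
  rw [sum_ellMin_eq c6a c6b c6c] at hcore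
  -- ### names for the pieces of the third term
  obtain ⟨Z₀, hZ₀⟩ : ∃ x : ℝ, x = ((m₂ : ℝ) - h + 1) * (h + m₂) / 2
      + 0.1603 * (((m₁ : ℝ) - m₂) * ((m₂ : ℝ) + 1 + m₁) / 2)
      - (1 - 0.1905 - 0.1603) * (((g : ℝ) - m₁) * ((m₁ : ℝ) + 1 + g) / 2) := ⟨_, rfl⟩
  obtain ⟨Z₁, hZ₁⟩ : ∃ x : ℝ, x = ((g : ℝ) - m₁) - ((m₂ : ℝ) + 1 - h) := ⟨_, rfl⟩
  obtain ⟨Q, hQ⟩ : ∃ x : ℝ, x = 0.1905 * (0.001 * (k : ℝ) ^ 2) + 0.1603 * E₂ := ⟨_, rfl⟩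
  obtain ⟨G, hG⟩ : ∃ x : ℝ, x = (k : ℝ) ^ (θ₁ * (k : ℝ) ^ 3) * Real.exp CT4n * (5 * (r : ℝ)) ^ k
      * (16 * (g : ℝ) * 4 ^ g * s) ^ (g - h + 1) := ⟨_, rfl⟩
  rw [← hZ₀, ← hZ₁, ← hG] at hcore
  have hXQ : 0.1905 * (0.001 * (k : ℝ) ^ 2) + 0.1603 * E₂ - (Z₀ + Z₁ * lam) = Q - (Z₀ + Z₁ * lam) := by
    rw [hQ]
  rw [hXQ] at hcore
  -- positivity
  have hg0 : (0 : ℝ) < g := by exact_mod_cast (show 0 < g by omega)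
  have hs0 : (0 : ℝ) < s := by exact_mod_cast hs1
  have hKw0 : (0 : ℝ) < 16 * (g : ℝ) * 4 ^ g * s := by positivity
  have h5r : (0 : ℝ) < 5 * r := by positivity
  have hGpos : 0 < G := by
    rw [hG]
    exact mul_pos (mul_pos (mul_pos (Real.rpow_pos_of_pos hkpos _) (Real.exp_pos _)) (pow_pos h5r k))
      (pow_pos hKw0 _)
  have hτ : ((g - h + 1 : ℕ) : ℝ) = (g : ℝ) - h + 1 := by
    rw [Nat.cast_add, Nat.cast_sub hhg]; push_cast; ring
  -- ### logarithms of the constants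
  have hlogG : Real.log G = θ₁ * (k : ℝ) ^ 3 * Real.log k + CT4n + k * Real.log (5 * r)
      + ((g : ℝ) - h + 1) * Real.log (16 * (g : ℝ) * 4 ^ g * s) := by
    rw [hG, Real.log_mul (mul_pos (mul_pos (Real.rpow_pos_of_pos hkpos _) (Real.exp_pos _)) (pow_pos h5r k)).ne'
        (pow_pos hKw0 _).ne',
      Real.log_mul (mul_pos (Real.rpow_pos_of_pos hkpos _) (Real.exp_pos _)).ne' (pow_pos h5r k).ne',
      Real.log_mul (Real.rpow_pos_of_pos hkpos _).ne' (Real.exp_pos _).ne',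
      Real.log_rpow hkpos, Real.log_exp, Real.log_pow, Real.log_pow, hτ]
  have hfac0 : (0 : ℝ) < (wp + 1).factorial := by exact_mod_cast Nat.factorial_pos _
  have hηL : 0 < η * 0.1603 := by positivity
  have hlogC₃ : Real.log C₃ = wp * Real.log (208 / 7) + Real.log ((wp + 1).factorial : ℝ)
      + Real.log (η * 0.1603) + Real.log L := by
    rw [hC₃def, hlogM₂, show η * (0.1603 * L) = (η * 0.1603) * L by ring,
      Real.log_mul (mul_pos (pow_pos (by norm_num) wp) hfac0).ne' (mul_pos hηL hLpos).ne',
      Real.log_mul (pow_pos (by norm_num) wp).ne' hfac0.ne', Real.log_pow,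
      Real.log_mul hηL.ne' hLpos.ne']
    ring
  have hlogfac : Real.log ((wp + 1).factorial : ℝ) ≤ ((wp : ℝ) + 2) * Real.log ((wp : ℝ) + 2) - ((wp : ℝ) + 1) := by
    have := log_factorial_le (wp + 1)
    push_cast at this
    convert this using 2; ring
  -- `log L ≤ E₃ L`
  have hE₃ : Real.log L ≤ Real.log (300 * lamlo ^ 2) / (300 * lamlo ^ 2) * L := by
    refine log_le_mul_of_ge ?_ hLlo
    have := Real.exp_one_lt_d9
    nlinarith only [this, c0]
  -- ### the exponent: `c9` at `lam` by affine interpolation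
  obtain ⟨d', hd'⟩ : ∃ x : ℝ, x = 1 / (133.66 * lamlo ^ 2) := ⟨_, rfl⟩
  have hrs0 : (0 : ℝ) < 2 * (r : ℝ) * s := by positivity
  have hexp_le : Real.log (300 * lamlo ^ 2) / (300 * lamlo ^ 2) / r + (Q - (Z₀ + Z₁ * lam)) / (2 * (r : ℝ) * s)
      + d' ≤ 0 := by
    have c9lo := c9 lamlo (Or.inl rfl)
    have c9hi := c9 lamhi (Or.inr rfl)
    rw [← hrreal, ← hE₂, ← hZ₀, ← hZ₁, ← hQ, ← hd'] at c9lo c9hi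
    rcases le_or_gt 0 Z₁ with hz | hz
    · have : (Q - (Z₀ + Z₁ * lam)) / (2 * (r : ℝ) * s) ≤ (Q - (Z₀ + Z₁ * lamlo)) / (2 * (r : ℝ) * s) :=
        div_le_div_of_nonneg_right (by nlinarith only [hz, hlamlo]) hrs0.le
      linarith only [this, c9lo]
    · have : (Q - (Z₀ + Z₁ * lam)) / (2 * (r : ℝ) * s) ≤ (Q - (Z₀ + Z₁ * lamhi)) / (2 * (r : ℝ) * s) :=
        div_le_div_of_nonneg_right (by nlinarith only [hz, hlamhi]) hrs0.le
      linarith only [this, c9hi]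
  -- ### the defect of `θ₁, CT4n` against the certified `θ, CT4`: at most `0.05`
  have hg0' : (0 : ℝ) < g := by exact_mod_cast (show 0 < g by omega)
  have hΔ : 1 / (2 * (r : ℝ) * s) * (θ₁ * (k : ℝ) ^ 3 * Real.log k + CT4n + k * Real.log (5 * r)
        + ((g : ℝ) - h + 1) * Real.log (16 * (g : ℝ) * 4 ^ g * s))
      ≤ 1 / (2 * (r : ℝ) * s) * (θ * (k : ℝ) ^ 3 * Real.log k + CT4 + k * Real.log (5 * r)
        + ((g : ℝ) - h + 1) * Real.log (16 * (g : ℝ) * 4 ^ g * s)) + 0.05 := by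
    -- `2rs ≥ k⁴/18.75`
    have hr32 : 3.2 * (k : ℝ) ^ 2 ≤ r := by
      rw [hrreal]
      have := Nat.lt_floor_add_one (ρ * (k : ℝ) ^ 2)
      nlinarith only [this, hρ, hkpos]
    have hs120 : (k : ℝ) ^ 2 ≤ 120 * s := by exact_mod_cast hks
    have hprod := mul_le_mul hr32 hs120 (by positivity) hr0.le
    -- the `θ` part
    have hlogk1 : Real.log k ≤ k := (Real.log_le_sub_one_of_pos hkpos).trans (by linarith only [hkpos])
    have hθterm : (θ₁ - θ) * ((k : ℝ) ^ 3 * Real.log k) ≤ 0.0008 * (k : ℝ) ^ 4 := by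
      have h2 : 0 ≤ (k : ℝ) ^ 3 * Real.log k :=
        mul_nonneg (by positivity) (Real.log_nonneg (by linarith only [hk133]))
      calc (θ₁ - θ) * ((k : ℝ) ^ 3 * Real.log k) ≤ 0.0008 * ((k : ℝ) ^ 3 * Real.log k) :=
            mul_le_mul_of_nonneg_right (by linarith only [hθ1]) h2
        _ ≤ 0.0008 * ((k : ℝ) ^ 3 * k) :=
            mul_le_mul_of_nonneg_left (mul_le_mul_of_nonneg_left hlogk1 (by positivity)) (by norm_num)
        _ = 0.0008 * (k : ℝ) ^ 4 := by ring
    -- the bracket of `CT4` is at most `1/η`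
    have hbr : (1 / η + h) * (1 - 1 / (h : ℝ)) ^ ((s : ℝ) / ((g : ℝ) - h + 1)) - h ≤ 1 / η := by
      have h1h : (1 : ℝ) ≤ h := by exact_mod_cast c7b
      have hp1 : (1 - 1 / (h : ℝ)) ^ ((s : ℝ) / ((g : ℝ) - h + 1)) ≤ 1 := by
        apply Real.rpow_le_one
        · rw [sub_nonneg, div_le_one (by positivity)]; exact h1h
        · have : 0 ≤ 1 / (h : ℝ) := by positivity
          linarith only [this]
        · exact div_nonneg (by positivity) (by rw [← hτ]; positivity)
      have := mul_le_of_le_one_right (by positivity : 0 ≤ 1 / η + h) hp1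
      linarith only [this]
    have hlog12 : Real.log (1 / (10 * η)) - Real.log (1 / (12 * η)) = Real.log 1.2 := by
      rw [← Real.log_div (by positivity) (by positivity)]
      congr 1
      field_simp
      norm_num
    have hlog12' : Real.log (1.2 : ℝ) ≤ 0.2 := by
      have := Real.log_le_sub_one_of_pos (show (0 : ℝ) < 1.2 by norm_num); linarith only [this]
    have hCTdiff : CT4n - CT4 = s * ((1 / η + h) * (1 - 1 / (h : ℝ)) ^ ((s : ℝ) / ((g : ℝ) - h + 1)) - h)
        * Real.log 1.2 := by
      rw [hCT4n, hCT4, ← hlog12]; ring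
    have hCTle : CT4n - CT4 ≤ 0.2 * s * (1 / η) := by
      rw [hCTdiff]
      have hl0 : 0 ≤ Real.log (1.2 : ℝ) := Real.log_nonneg (by norm_num)
      have e1 := mul_le_mul_of_nonneg_right (mul_le_mul_of_nonneg_left hbr hs0.le) hl0
      have e2 : (s : ℝ) * (1 / η) * Real.log 1.2 ≤ (s : ℝ) * (1 / η) * 0.2 :=
        mul_le_mul_of_nonneg_left hlog12' (by positivity)
      linarith only [e1, e2]
    -- `1/η ≤ 0.765 g² ≤ 0.765 k²` from (1.10) (`c4d`) and `log g ≥ 4`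
    have hlogg4 : 4 ≤ Real.log g := by
      rw [Real.le_log_iff_exp_le hg0']
      have e4 : Real.exp (4 : ℝ) = Real.exp 1 ^ 4 := by rw [← Real.exp_nat_mul]; norm_num
      have he := Real.exp_one_lt_d9
      have hg60 : (60 : ℝ) ≤ g := by exact_mod_cast c2a
      have : Real.exp 1 ^ 4 ≤ (2.7182818286 : ℝ) ^ 4 :=
        pow_le_pow_left₀ (Real.exp_pos 1).le he.le 4
      rw [e4]
      linarith only [this, hg60, show (2.7182818286 : ℝ) ^ 4 ≤ 55 by norm_num]
    have c4d' := c4d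
    rw [div_le_iff₀ (by positivity)] at c4d'
    have hηinv : 1 / η ≤ 0.765 * (k : ℝ) ^ 2 := by
      have hgk : (g : ℝ) ≤ k := by exact_mod_cast c7c
      have hgk2 : (g : ℝ) ^ 2 ≤ (k : ℝ) ^ 2 := pow_le_pow_left₀ hg0'.le hgk 2
      rw [div_le_iff₀ hη]
      nlinarith only [c4d', hlogg4, hgk2, hη]
    have hdiff : θ₁ * (k : ℝ) ^ 3 * Real.log k + CT4n
        ≤ θ * (k : ℝ) ^ 3 * Real.log k + CT4 + (0.0008 * (k : ℝ) ^ 4 + 0.153 * s * (k : ℝ) ^ 2) := by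
      have : 0.2 * (s : ℝ) * (1 / η) ≤ 0.2 * s * (0.765 * (k : ℝ) ^ 2) :=
        mul_le_mul_of_nonneg_left hηinv (by positivity)
      nlinarith only [hθterm, hCTle, this]
    have hbound : 0.0008 * (k : ℝ) ^ 4 + 0.153 * s * (k : ℝ) ^ 2 ≤ 0.05 * (2 * (r : ℝ) * s) := by
      nlinarith only [hprod, hr32, hs0, hkpos]
    have hinv0 : 0 ≤ 1 / (2 * (r : ℝ) * s) := by positivity
    have key := mul_le_mul_of_nonneg_left (show θ₁ * (k : ℝ) ^ 3 * Real.log k + CT4n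
        ≤ θ * (k : ℝ) ^ 3 * Real.log k + CT4 + 0.05 * (2 * (r : ℝ) * s) by linarith only [hdiff, hbound]) hinv0
    have e : 1 / (2 * (r : ℝ) * s) * (θ * (k : ℝ) ^ 3 * Real.log k + CT4 + 0.05 * (2 * (r : ℝ) * s))
        = 1 / (2 * (r : ℝ) * s) * (θ * (k : ℝ) ^ 3 * Real.log k + CT4) + 0.05 := by
      field_simp
    rw [e] at key
    nlinarith only [key, hinv0]
  -- ### the third term `≤ (Ctar - 0.002) e^{0.05} N^{1 - d'}`
  have hCt : 0 < Ctar - 0.002 := by linarith only [hCtar]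
  have hCte : 0 < (Ctar - 0.002) * Real.exp 0.05 := mul_pos hCt (Real.exp_pos _)
  have hthird : C₃ ^ (1 / (r : ℝ)) * G ^ (1 / (2 * (r : ℝ) * s))
      * (N : ℝ) ^ (1 + (Q - (Z₀ + Z₁ * lam)) / (2 * (r : ℝ) * s))
      ≤ (Ctar - 0.002) * Real.exp 0.05 * (N : ℝ) ^ (1 - d') := by
    have hlhs : 0 < C₃ ^ (1 / (r : ℝ)) * G ^ (1 / (2 * (r : ℝ) * s))
        * (N : ℝ) ^ (1 + (Q - (Z₀ + Z₁ * lam)) / (2 * (r : ℝ) * s)) :=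
      mul_pos (mul_pos (Real.rpow_pos_of_pos hC₃pos _) (Real.rpow_pos_of_pos hGpos _))
        (Real.rpow_pos_of_pos hN0 _)
    have hrhs : 0 < (Ctar - 0.002) * Real.exp 0.05 * (N : ℝ) ^ (1 - d') :=
      mul_pos hCte (Real.rpow_pos_of_pos hN0 _)
    rw [← Real.log_le_log_iff hlhs hrhs,
      Real.log_mul (mul_pos (Real.rpow_pos_of_pos hC₃pos _) (Real.rpow_pos_of_pos hGpos _)).ne'
        (Real.rpow_pos_of_pos hN0 _).ne',
      Real.log_mul (Real.rpow_pos_of_pos hC₃pos _).ne' (Real.rpow_pos_of_pos hGpos _).ne',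
      Real.log_rpow hC₃pos, Real.log_rpow hGpos, Real.log_rpow hN0, Real.log_mul hCte.ne' (Real.rpow_pos_of_pos hN0 _).ne',
      Real.log_mul hCt.ne' (Real.exp_pos _).ne', Real.log_exp,
      Real.log_rpow hN0, ← hL, hlogC₃, hlogG]
    rw [← hrreal, ← hCT4] at c8
    -- the coefficient `1/r · log L ≤ E₃/r · L`
    have h1 : 1 / (r : ℝ) * Real.log L ≤ 1 / (r : ℝ) * (Real.log (300 * lamlo ^ 2) / (300 * lamlo ^ 2) * L) :=
      mul_le_mul_of_nonneg_left hE₃ (by positivity)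
    have h2 : 1 / (r : ℝ) * Real.log ((wp + 1).factorial : ℝ)
        ≤ 1 / (r : ℝ) * (((wp : ℝ) + 2) * Real.log ((wp : ℝ) + 2) - ((wp : ℝ) + 1)) :=
      mul_le_mul_of_nonneg_left hlogfac (by positivity)
    have h3 : (Real.log (300 * lamlo ^ 2) / (300 * lamlo ^ 2) / r + (Q - (Z₀ + Z₁ * lam)) / (2 * (r : ℝ) * s)
        + d') * L ≤ 0 := mul_nonpos_of_nonpos_of_nonneg hexp_le hLpos.le
    have e1 : Real.log (300 * lamlo ^ 2) / (300 * lamlo ^ 2) / r * L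
        = 1 / (r : ℝ) * (Real.log (300 * lamlo ^ 2) / (300 * lamlo ^ 2) * L) := by ring
    have e2 : (1 + (Q - (Z₀ + Z₁ * lam)) / (2 * (r : ℝ) * s)) * L
        = L + (Q - (Z₀ + Z₁ * lam)) / (2 * (r : ℝ) * s) * L := by ring
    have e3 : (1 - d') * L = L - d' * L := by ring
    nlinarith only [c8, h1, h2, h3, e1, e2, e3, hΔ]
  -- ### the saving `d = 1/(133.66 λ²)` and `d ≤ d' ≤ 10⁻⁶`
  obtain ⟨d, hd⟩ : ∃ x : ℝ, x = 1 / (133.66 * lam ^ 2) := ⟨_, rfl⟩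
  have hgoal : 1 - L ^ 2 / (133.66 * Real.log t ^ 2) = 1 - d := by
    rw [hd, hlogt]; field_simp
  rw [hgoal]
  have hdd' : d ≤ d' := by
    rw [hd, hd']
    exact one_div_le_one_div_of_le (by positivity) (by nlinarith only [hlamlo, c0])
  have hd'small : d' ≤ 1e-6 := by
    rw [hd', div_le_iff₀ (by positivity)]; nlinarith only [c0]
  have hd0 : 0 ≤ d := by rw [hd]; positivity
  set X : ℝ := (N : ℝ) ^ (1 - d) with hX
  have hXpos : 0 < X := Real.rpow_pos_of_pos hN0 _
  have hpow_le : (N : ℝ) ^ (1 - d') ≤ X := Real.rpow_le_rpow_of_exponent_le hN1.le (by linarith only [hdd'])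
  -- ### `T1 ≤ 0.0005 X`
  have hT1 : 2 * (N : ℝ) ^ (0.1905 : ℝ) * (N : ℝ) ^ (0.1603 : ℝ) ≤ 0.0005 * X := by
    have e1 : 2 * (N : ℝ) ^ (0.1905 : ℝ) * (N : ℝ) ^ (0.1603 : ℝ) = 2 * (N : ℝ) ^ (0.3508 : ℝ) := by
      rw [mul_assoc, ← Real.rpow_add hN0]; norm_num
    have e2 : X = (N : ℝ) ^ (0.3508 : ℝ) * (N : ℝ) ^ (0.6492 - d) := by
      rw [hX, ← Real.rpow_add hN0]; ring_nf
    have h1 : (4000 : ℝ) ≤ (N : ℝ) ^ (0.6492 - d) := by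
      have : (4000 : ℝ) ≤ (N : ℝ) ^ (0.6 : ℝ) := by
        rw [Real.rpow_def_of_pos hN0, ← hL]
        have := Real.add_one_le_exp (L * 0.6)
        nlinarith only [this, hLge]
      exact this.trans (Real.rpow_le_rpow_of_exponent_le hN1.le (by linarith only [hdd', hd'small]))
    rw [e1, e2]
    have : (0 : ℝ) ≤ (N : ℝ) ^ (0.3508 : ℝ) := by positivity
    nlinarith only [h1, this]
  -- ### `T2 ≤ 0.0015 X`
  have hT2 : t * ((N : ℝ) ^ (0.1905 : ℝ) * (N : ℝ) ^ (0.1603 : ℝ)) ^ (k + 1) / ((k + 1) * (N : ℝ) ^ k)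
      ≤ 0.0015 * X := by
    have e1 : t * ((N : ℝ) ^ (0.1905 : ℝ) * (N : ℝ) ^ (0.1603 : ℝ)) ^ (k + 1) / ((k + 1) * (N : ℝ) ^ k)
        = (N : ℝ) ^ (lam + 0.3508 * ((k : ℝ) + 1) - k) / ((k : ℝ) + 1) := by
      rw [ht, ← Real.rpow_add hN0, ← Real.rpow_natCast, ← Real.rpow_mul hN0.le, ← Real.rpow_add hN0,
        ← Real.rpow_natCast (N : ℝ) k, Real.rpow_sub hN0]
      push_cast
      field_simp
      ring_nf
    have hexp2 : lam + 0.3508 * ((k : ℝ) + 1) - k ≤ (1 - d) + (-9e-7) := by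
      linarith only [c1, hlamhi, hdd', hd'small]
    have h2 : (N : ℝ) ^ (lam + 0.3508 * ((k : ℝ) + 1) - k) ≤ X * (N : ℝ) ^ (-9e-7 : ℝ) := by
      rw [hX, ← Real.rpow_add hN0]
      exact Real.rpow_le_rpow_of_exponent_le hN1.le hexp2
    have h3 : (N : ℝ) ^ (-9e-7 : ℝ) ≤ 0.2 := by
      rw [Real.rpow_neg hN0.le, ← one_div, div_le_iff₀ (Real.rpow_pos_of_pos hN0 _), ← div_le_iff₀' (by norm_num)]
      rw [Real.rpow_def_of_pos hN0, ← hL]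
      have := Real.quadratic_le_exp_of_nonneg (show (0 : ℝ) ≤ L * 9e-7 by positivity)
      nlinarith only [this, hLge]
    have hk1' : (134 : ℝ) ≤ (k : ℝ) + 1 := by linarith only [hk133]
    rw [e1, div_le_iff₀ (by positivity)]
    calc (N : ℝ) ^ (lam + 0.3508 * ((k : ℝ) + 1) - k) ≤ X * (N : ℝ) ^ (-9e-7 : ℝ) := h2
      _ ≤ X * 0.2 := mul_le_mul_of_nonneg_left h3 hXpos.le
      _ ≤ 0.0015 * X * ((k : ℝ) + 1) := by nlinarith only [hk1', hXpos]
  -- ### total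
  have hthird' : C₃ ^ (1 / (r : ℝ)) * G ^ (1 / (2 * (r : ℝ) * s))
      * (N : ℝ) ^ (1 + (Q - (Z₀ + Z₁ * lam)) / (2 * (r : ℝ) * s)) ≤ (Ctar - 0.002) * Real.exp 0.05 * X :=
    hthird.trans (mul_le_mul_of_nonneg_left hpow_le hCte.le)
  have hexp5 : Real.exp 0.05 ≤ 1.0527 := by
    have h1 := Real.add_one_le_exp (-0.05 : ℝ)
    have h2 : Real.exp (-0.05 : ℝ) * Real.exp 0.05 = 1 := by rw [← Real.exp_add]; norm_num
    nlinarith only [h1, h2, Real.exp_pos (0.05 : ℝ)]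
  have hthird'' : (Ctar - 0.002) * Real.exp 0.05 * X ≤ (1.06 * Ctar - 0.002) * X :=
    mul_le_mul_of_nonneg_right (by nlinarith only [hexp5, hCt, Real.exp_pos (0.05 : ℝ)]) hXpos.le
  linarith only [hcore, hT1, hT2, hthird', hthird'']

/-! ### The trivial range `log N ≤ 300 λ²` -/


end FordVK
end Literature.NumberTheory.LFunctions
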